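import Summits.BirchSwinnertonDyer.Rank1Residual.Additive.TameBranchOfTwistPartner
import HarnessLib

/-!
# Class N10, tame branch, E3 TWIST TRANSPORT at the Λ-level (kernel half): a `1`-periodic
# HECKE-eigen lattice-valued symbol `S` whose `χ⁻¹`-twist is `[·]⁺_f` yields an ORDINARY TWIST
# PARTNER `Φ = S − α⁻¹δ·S(p·)` (the `p`-stabilisation) with the EXPLICIT unit `α`, hence the
# E-normalised tame branch `IsTameBranchOf f p (ι∘χ) α B`
# (cell `b2b-bsdres`, lane CLASS-CLOSURE, seat cc-typer-2 GEN 3; plan §3.2 E3 "(M): twist of a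
# multiplicative curve; (G-ord): twist of a good-ordinary curve"; N10/TRANSPORT-TEMPLATE.md R2)

HONEST FRAMING (cell `b2b-bsdres`, run/shared/lean/b2b/bsd-rank1-residual/, verbatim in every
file): the goal of the cell is to DELETE the COMBINATION-SHAPED residual classes of the
Birch–Swinnerton-Dyer formula for ALL analytic-rank `≤ 1` elliptic curves over `ℚ` — "full BSD
formula for every rank `≤ 1` curve in class `C`" assembled STRICTLY from published theorems — so
that the rank-`≤ 1` remainder becomes exactly the CONSTRUCTION-SHAPED classes, which are TYPED
(missing-input `Prop`s), NOT attempted. This is not "finishing BSD". Lane CLASS-CLOSURE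
(coordinator ruling 2026-08-21T04:07Z): research routes, no claim beyond the stated classes;
census output = EVIDENCE / conjecture items with held-out validation, NEVER a Literature fact;
the class N10 stays CONSTRUCTION-shaped (RESIDUAL-MAP §I); NOTHING is booked. THEOREMS plus ONE
auxiliary definition (the `p`-stabilised symbol, written out as data); no named fact, no conjecture
node; labels / RESIDUAL-MAP marks UNCHANGED.

## What and why (E3 = TRANSPORT SEARCH, twist; comparison statement made precise)

On N10's defect-2 loci ((M) = Kodaira `I_n*`, `E = E♭ ⊗ χ_{p*}` with `E♭` MULTIPLICATIVE at `p`;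
(G-ord, `e = 2`) = `I₀*` with `E♭` GOOD ORDINARY at `p`) the tame character is quadratic and the
"twist partner" of census X4-3's typed input `CensusX43.HasOrdinaryTwistPartner χ f`
(`Additive/CensusX43ValueModule.lean`) is not a newform with nebentypus but the `p`-STABILISED
symbol of the twist curve `E♭`: with `S = c·[·]^{sgn χ}_{f♭}` (`c ∈ ℚ` a period ratio),
`Φ(s) = S(s) − α⁻¹ S(ps)` (good ordinary, `α` the unit root of `X² − a_p(E♭)X + p`) resp.
`Φ = S` (multiplicative, `α = a_p(E♭) = ±1`). THIS FILE is the KERNEL half of that transport,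
abstractly in `ℚ_p`-currency (Mazur–Tate–Teitelbaum 1986 §I.10 (10.1)–(10.2): the measure
`α^{−n}[a/pⁿ] − α^{−(n+1)}[a/p^{n−1}]` of the `p`-stabilised form): GIVEN
* `S : ℚ → ℚ_p` `1`-periodic with values in ONE rank-one lattice `c·ℤ_p` (bounded denominators —
  Manin–Drinfeld for `[·]^±_{f♭}`, tree `exists_forall_ratPlusSymbol_eq_div`),
* the HECKE RELATION at `p` in the tree's shape `a_p·S(r) = ∑_{j mod p} S((r+j)/p) + δ·S(pr)`
  (`δ = 1`: `T_p`, `p ∤ N♭`, tree `intCast_mul_ratPlusSymbol`; `δ = 0`: `U_p`, `p ∣ N♭`, tree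
  `intCast_mul_ratPlusSymbol_of_dvd`; any `‖δ‖ ≤ 1` is allowed),
* a unit root `α`: `α² − a_p α + δp = 0`, `‖α‖ = 1`,
* and THE COMPARISON STATEMENT — the symbol-level twist identity `[s]⁺_f = ∑_{u mod p} χ⁻¹(u) S(s + u/p)`
  (`hx`; for `f = f_E`, `S = c·[·]^±_{f♭}` this is the modular-symbol form of
  `f_E = f♭ ⊗ χ = τ(χ̄)⁻¹ ∑_u χ̄(u) f♭(· + u/p)`, Shimura 1971 Prop. 3.64 / Atkin–Li 1978 §3, tree
  `coe_charTwist`; MTT §I.8: its proof from the tree's `charTwist` is the classical half of the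
  transport and is NOT done in this file — it enters as an explicit binder),
THEN (`hasOrdinaryTwistPartner_of_heckeSymbol`) `Φ` is an ordinary twist partner with eigenvalue
EXACTLY `α` — `1`-periodic, `τ_{χ⁻¹}Φ = [·]⁺_f` (the stabilising term twists to `0` because
`∑_u χ⁻¹(u) = 0`), `∑_d Φ(s + d/p) = α Φ(ps)` (the Hecke relation at `r = ps` and
`α a_p − δp = α²`), sup attained (`exists_forall_norm_le_norm_of_forall_eq_mul`: a `c·ℤ_p`-valued
function attains its sup norm) — and (`exists_isTameBranchOf_of_heckeSymbol`, through the bridge of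
`TameBranchOfTwistPartner.lean` run with EXPLICIT data, `exists_isTameBranchOf_of_twistPartnerData`)
there is an E-normalised tame branch `B` with `IsTameBranchOf f p (ι∘χ) α B` for THE unit `α` and
the integrality transfer `max‖[Tⁿ]B‖ ≤ max‖[·]⁺_f‖`. So on defect 2 the premise of the typed main
conjecture `TameBranchRatCharEqAt W p` (`TameBranchLower.lean`) is inhabited by an object built from
`E♭`'s Mazur–Tate–Teitelbaum measure, with `α = unitRoot E♭ p` resp. `a_p(E♭)`, MODULO the one
comparison statement `hx`; the instantiation `S := c·[·]^±_{f♭}` with the tree's Hecke relations is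
the companion `TameBranchOfSemistableTwist.lean`. Pure `p`-adic bookkeeping; no modular-forms input
is consumed here; nothing booked.

References: Mazur–Tate–Teitelbaum, Invent. Math. 84 (1986) §I.4 (4.2), §I.8, §I.10 (10.1)–(10.2),
§I.11–I.14 [MazurTateTeitelbaum1986Invent]; Shimura 1971 Prop. 3.64 [Shimura1971]; Atkin–Li,
Invent. Math. 48 (1978) §3 [AtkinLi1978]; Delbourgo, Compositio 113 (1998) §1.5, hypothesis (M)
p. 133 [Delbourgo1998]; HOME/class-closure/N10/TRANSPORT-TEMPLATE.md R2.
-/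

noncomputable section

open scoped Classical MatrixGroups ModularForm

open CongruenceSubgroup

namespace Summit.BirchSwinnertonDyer.Rank1Residual.Additive

open Literature.NumberTheory.EllipticCurves Literature.NumberTheory.EllipticCurves.ModularForms

/-! ### §1 A lattice-valued function on `ℚ` attains its `p`-adic sup norm -/

section Sup

variable {p : ℕ} [hp : Fact p.Prime]

/-- **A `c·ℤ_p`-valued function attains its sup norm.** If `Φ : ℚ → ℚ_p` takes values in one
rank-one lattice `c·ℤ_p` (e.g. a modular symbol with bounded denominators, times a period ratio),
then `‖Φ‖` attains its supremum: the norms of the non-zero values are `‖c‖·p^{−k}`, `k ∈ ℕ`, and a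
non-empty set of naturals has a least element. (The "sup attained" clause of
`CensusX43.HasOrdinaryTwistPartner`.) [folklore] -/
theorem exists_forall_norm_le_norm_of_forall_eq_mul {Φ : ℚ → ℚ_[p]} {c : ℚ_[p]}
    (h : ∀ s, ∃ z : ℤ_[p], Φ s = c * z) : ∃ s₁, ∀ s, ‖Φ s‖ ≤ ‖Φ s₁‖ := by
  by_cases hall : ∀ s, Φ s = 0
  · exact ⟨0, fun s ↦ by rw [hall s, norm_zero]; exact norm_nonneg _⟩
  obtain ⟨s₀, hs₀⟩ := not_forall.mp hall
  have hP : ∃ k : ℕ, ∃ s, ∃ z : ℤ_[p], z ≠ 0 ∧ Φ s = c * z ∧ z.valuation = k := by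
    obtain ⟨z₀, hz₀⟩ := h s₀
    have hz0 : z₀ ≠ 0 := by
      rintro rfl
      rw [PadicInt.coe_zero, mul_zero] at hz₀
      exact hs₀ hz₀
    exact ⟨z₀.valuation, s₀, z₀, hz0, hz₀, rfl⟩
  obtain ⟨s₁, z₁, hz₁0, hz₁, hval₁⟩ := Nat.find_spec hP
  refine ⟨s₁, fun s ↦ ?_⟩
  by_cases hs : Φ s = 0
  · rw [hs, norm_zero]; exact norm_nonneg _
  obtain ⟨z, hz⟩ := h s
  have hz0 : z ≠ 0 := by
    rintro rfl
    rw [PadicInt.coe_zero, mul_zero] at hz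
    exact hs hz
  have hmin : Nat.find hP ≤ z.valuation := Nat.find_min' hP ⟨s, z, hz0, hz, rfl⟩
  rw [hz, hz₁, norm_mul, norm_mul, PadicInt.padic_norm_e_of_padicInt,
    PadicInt.padic_norm_e_of_padicInt, PadicInt.norm_eq_zpow_neg_valuation hz0,
    PadicInt.norm_eq_zpow_neg_valuation hz₁0, hval₁]
  have hp1 : (1 : ℝ) ≤ p := Nat.one_le_cast.mpr hp.out.one_lt.le
  exact mul_le_mul_of_nonneg_left (zpow_le_zpow_right₀ hp1 (by omega)) (norm_nonneg c)

end Sup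

/-! ### §2 The `p`-stabilised symbol of a Hecke-eigen symbol is an ordinary twist partner -/

section HeckeSymbol

variable {p : ℕ} [hp : Fact p.Prime]

/-- **The `p`-stabilised symbol** `Φ(s) = S(s) − α⁻¹·δ·S(ps)` of a symbol `S : ℚ → ℚ_p` at the
root `α` of `X² − a_p X + δ p` (Mazur–Tate–Teitelbaum 1986 §I.10 (10.1): the measure of the
`p`-stabilised form is `α^{−n}Φ(a/pⁿ)`; `δ = 1` at a good prime, `δ = 0` at a prime dividing the
level, where `Φ = S`). Data only; nothing asserted. [cite: MazurTateTeitelbaum1986Invent, §I.10 (10.1)] -/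
def stabilisedSymbol (S : ℚ → ℚ_[p]) (α δ : ℚ_[p]) (s : ℚ) : ℚ_[p] :=
  S s - α⁻¹ * δ * S (p * s)

/-- Unfolding lemma for `stabilisedSymbol`. [folklore] -/
@[simp] theorem stabilisedSymbol_apply (S : ℚ → ℚ_[p]) (α δ : ℚ_[p]) (s : ℚ) :
    stabilisedSymbol S α δ s = S s - α⁻¹ * δ * S (p * s) := rfl

variable {S : ℚ → ℚ_[p]} {ap α δ c : ℚ_[p]}

/-- The stabilised symbol of a `1`-periodic symbol is `1`-periodic (`S(ps + p) = S(ps)`). [folklore] -/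
theorem stabilisedSymbol_add_one (hper : ∀ s, S (s + 1) = S s) (s : ℚ) :
    stabilisedSymbol S α δ (s + 1) = stabilisedSymbol S α δ s := by
  simp only [stabilisedSymbol_apply]
  rw [hper, mul_add, mul_one, CensusX43.periodic_natCast hper]

/-- **The stabilising term is invisible to a non-trivial twist**: `τ_ψ Φ = τ_ψ S` for `ψ ≠ 1`,
because `∑_u ψ(u) S(p(s + u/p)) = S(ps) ∑_u ψ(u) = 0` (`1`-periodicity). [folklore] -/
theorem twist_stabilisedSymbol (hper : ∀ s, S (s + 1) = S s) {ψ : MulChar (ZMod p) ℚ_[p]}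
    (hψ : ψ ≠ 1) (s : ℚ) :
    CensusX43.twist ψ (stabilisedSymbol S α δ) s = CensusX43.twist ψ S s := by
  have hp0 : (p : ℚ) ≠ 0 := Nat.cast_ne_zero.mpr hp.out.ne_zero
  simp only [CensusX43.twist, stabilisedSymbol_apply, mul_sub, Finset.sum_sub_distrib]
  have hS : ∀ b : ZMod p, S (p * (s + (b.val : ℚ) / p)) = S (p * s) := fun b ↦ by
    rw [mul_add, mul_div_cancel₀ _ hp0, CensusX43.periodic_natCast hper]
  simp_rw [hS]
  rw [show ∑ b : ZMod p, ψ b * (α⁻¹ * δ * S (p * s)) = (∑ b : ZMod p, ψ b) * (α⁻¹ * δ * S (p * s))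
    by rw [Finset.sum_mul], MulChar.sum_eq_zero_of_ne_one hψ, zero_mul, sub_zero]

/-- **The stabilised symbol is `U_p`-EIGEN with eigenvalue `α`**:
`∑_{d mod p} Φ(s + d/p) = α·Φ(ps)`, from the Hecke relation
`a_p S(r) = ∑_j S((r+j)/p) + δ S(pr)` at `r = ps`, `1`-periodicity (`∑_d S(ps + d) = p·S(ps)`) and
`α a_p − δ p = α²` (Mazur–Tate–Teitelbaum 1986 §I.10 Prop. (10.2): the distribution relation of the
stabilised measure). [cite: MazurTateTeitelbaum1986Invent, §I.10 Prop. (10.2)] -/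
theorem sum_stabilisedSymbol_eq (hper : ∀ s, S (s + 1) = S s)
    (hH : ∀ r : ℚ, ap * S r = ∑ j : Fin p, S ((r + ((j : ℕ) : ℚ)) / p) + δ * S (p * r))
    (hα : α ^ 2 - ap * α + δ * p = 0) (hα0 : α ≠ 0) (s : ℚ) :
    ∑ d : ZMod p, stabilisedSymbol S α δ (s + (d.val : ℚ) / p) =
      α * stabilisedSymbol S α δ (p * s) := by
  have hp0 : (p : ℚ) ≠ 0 := Nat.cast_ne_zero.mpr hp.out.ne_zero
  haveI : NeZero p := ⟨hp.out.ne_zero⟩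
  -- the Hecke relation at `r = ps`: `∑_d S(s + d/p) = a_p S(ps) − δ S(p·ps)`
  have hsum : ∑ d : ZMod p, S (s + (d.val : ℚ) / p) = ap * S (p * s) - δ * S (p * (p * s)) := by
    have h := hH (p * s)
    have hj : ∀ j : Fin p, S ((p * s + ((j : ℕ) : ℚ)) / p) = S (s + ((j : ℕ) : ℚ) / p) := fun j ↦ by
      congr 1; field_simp
    simp_rw [hj] at h
    rw [sum_fin_eq_sum_zmod_val (fun k : ℕ ↦ S (s + (k : ℚ) / p))] at h
    linear_combination -h
  -- the stabilising terms: `∑_d S(p(s + d/p)) = p · S(ps)`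
  have hstab : ∑ d : ZMod p, S (p * (s + (d.val : ℚ) / p)) = (p : ℚ_[p]) * S (p * s) := by
    have hS : ∀ d : ZMod p, S (p * (s + (d.val : ℚ) / p)) = S (p * s) := fun d ↦ by
      rw [mul_add, mul_div_cancel₀ _ hp0, CensusX43.periodic_natCast hper]
    simp_rw [hS]
    rw [Finset.sum_const, Finset.card_univ, ZMod.card, nsmul_eq_mul]
  simp only [stabilisedSymbol_apply]
  rw [Finset.sum_sub_distrib, hsum, ← Finset.mul_sum, hstab]
  have h1 : α⁻¹ * α = 1 := inv_mul_cancel₀ hα0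
  have hkey : ap - α⁻¹ * δ * p = α := by
    linear_combination (-α⁻¹) * hα - (ap - α) * h1
  linear_combination (S (p * s)) * hkey + (δ * S (p * (p * s))) * h1

/-- The stabilised symbol of a `c·ℤ_p`-valued symbol is `c·ℤ_p`-valued (`‖α⁻¹δ‖ ≤ 1`). [folklore] -/
theorem exists_stabilisedSymbol_eq_mul (hαu : ‖α‖ = 1) (hδ : ‖δ‖ ≤ 1)
    (hlat : ∀ s, ∃ z : ℤ_[p], S s = c * z) (s : ℚ) :
    ∃ z : ℤ_[p], stabilisedSymbol S α δ s = c * z := by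
  obtain ⟨z₁, hz₁⟩ := hlat s
  obtain ⟨z₂, hz₂⟩ := hlat (p * s)
  have hw : ‖α⁻¹ * δ‖ ≤ 1 := by rw [norm_mul, norm_inv, hαu, inv_one, one_mul]; exact hδ
  have hw' : (((⟨α⁻¹ * δ, hw⟩ : ℤ_[p]) : ℤ_[p]) : ℚ_[p]) = α⁻¹ * δ := rfl
  refine ⟨z₁ - ⟨α⁻¹ * δ, hw⟩ * z₂, ?_⟩
  rw [stabilisedSymbol_apply, hz₁, hz₂, PadicInt.coe_sub, PadicInt.coe_mul, hw']
  ring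

/-- **A Hecke-eigen lattice-valued symbol whose `χ⁻¹`-twist is `[·]⁺_f` gives an ORDINARY TWIST
PARTNER with eigenvalue `α`** (the census X4-3 typed input `CensusX43.HasOrdinaryTwistPartner χ f`,
here PRODUCED): inputs `S` `1`-periodic and `c·ℤ_p`-valued, the Hecke relation
`a_p S(r) = ∑_j S((r+j)/p) + δ S(pr)` (`‖δ‖ ≤ 1`; `δ = 1` good, `δ = 0` multiplicative), a unit root
`α` of `X² − a_p X + δp`, and the COMPARISON STATEMENT `[s]⁺_f = τ_{χ⁻¹}S(s)` (`hx`, the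
symbol-level twist identity — an explicit binder, see the module docstring); output: the
`p`-stabilised symbol `Φ = S − α⁻¹δ S(p·)` is a partner (`τ_{χ⁻¹}Φ = [·]⁺_f`, `U_pΦ = αΦ(p·)`,
sup attained). Mazur–Tate–Teitelbaum 1986 §I.10. [cite: MazurTateTeitelbaum1986Invent, §I.10 (10.1)–(10.2)] -/
theorem hasOrdinaryTwistPartner_of_heckeSymbol {N : ℕ} {f : CuspForm (Gamma0 N) 2}
    {χ : MulChar (ZMod p) ℚ_[p]} (hχ : χ ≠ 1) (hper : ∀ s, S (s + 1) = S s)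
    (hx : ∀ s, ((ratPlusSymbol f s : ℚ) : ℚ_[p]) = CensusX43.twist χ⁻¹ S s)
    (hH : ∀ r : ℚ, ap * S r = ∑ j : Fin p, S ((r + ((j : ℕ) : ℚ)) / p) + δ * S (p * r))
    (hα : α ^ 2 - ap * α + δ * p = 0) (hαu : ‖α‖ = 1) (hδ : ‖δ‖ ≤ 1)
    (hlat : ∀ s, ∃ z : ℤ_[p], S s = c * z) :
    CensusX43.HasOrdinaryTwistPartner χ f := by
  have hα0 : α ≠ 0 := fun h0 ↦ by rw [h0, norm_zero] at hαu; exact zero_ne_one hαu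
  have hχi : χ⁻¹ ≠ 1 := fun h1 ↦ hχ (inv_eq_one.mp h1)
  exact ⟨stabilisedSymbol S α δ, α, hαu, stabilisedSymbol_add_one hper,
    fun s ↦ by rw [hx s, twist_stabilisedSymbol hper hχi],
    sum_stabilisedSymbol_eq hper hH hα hα0,
    exists_forall_norm_le_norm_of_forall_eq_mul (exists_stabilisedSymbol_eq_mul hαu hδ hlat)⟩

end HeckeSymbol

/-! ### §3 The bridge run with EXPLICIT data: the tame branch for THE unit `ã` -/

section Bridge

variable {p : ℕ} [hp : Fact p.Prime] {N : ℕ} {f : CuspForm (Gamma0 N) 2}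

/-- **The bridge of `TameBranchOfTwistPartner.lean` with explicit data.** For a named partner
`(Φ, ã)` — `‖ã‖ = 1`, `Φ` `1`-periodic, `[·]⁺_f = τ_{χ⁻¹}Φ`, `∑_d Φ(s + d/p) = ã Φ(ps)`, sup
attained at `s₁` — the Mellin transform of `χ̄·μ_Φ` is an E-normalised tame branch FOR THAT `ã`:
`∃ B, IsTameBranchOf f p (ι∘χ) ã B` with the integrality transfer. (Verbatim the proof of
`exists_isTameBranchOf_of_hasOrdinaryTwistPartner`, which hides `ã` behind an `∃`; stated here so
that on defect 2 the unit is THE unit root of the twist curve.)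
[cite: MazurTateTeitelbaum1986Invent, §I.13–I.14 (14.3)] -/
theorem exists_isTameBranchOf_of_twistPartnerData {χ : MulChar (ZMod p) ℚ_[p]} (hχ : χ ≠ 1)
    {Φ : ℚ → ℚ_[p]} {ã : ℚ_[p]} (hã : ‖ã‖ = 1) (hper : ∀ s, Φ (s + 1) = Φ s)
    (hx : ∀ s, ((ratPlusSymbol f s : ℚ) : ℚ_[p]) = CensusX43.twist χ⁻¹ Φ s)
    (hU : ∀ s, ∑ d : ZMod p, Φ (s + (d.val : ℚ) / p) = ã * Φ (p * s))
    {s₁ : ℚ} (hs₁ : ∀ s, ‖Φ s‖ ≤ ‖Φ s₁‖) :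
    ∃ B : PowerSeries ℚ_[p], IsTameBranchOf f p (χ.ringHomComp (algebraMap ℚ_[p] ℂ_[p])) ã B ∧
      ∀ C : ℝ, (∀ r : ℚ, ‖((ratPlusSymbol f r : ℚ) : ℚ_[p])‖ ≤ C) →
        ∀ n : ℕ, ‖PowerSeries.coeff n B‖ ≤ C := by
  have hã0 : ã ≠ 0 := fun h0 ↦ by rw [h0, norm_zero] at hã; exact zero_ne_one hã
  have hx' : ∀ s, ((ratPlusSymbol f s : ℚ) : ℚ_[p]) = ∑ c : ZMod p, χ⁻¹ c * Φ (s + (c.val : ℚ) / p) :=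
    hx
  have hdist := twistPartnerMeasure_distribution χ hã0 hx' hU
  have hC := norm_twistPartnerMeasure_le χ hã hx' hs₁
  obtain ⟨L, hbd, h0, hint⟩ := exists_powerSeries_of_bounded_distribution hdist hC
  refine ⟨L, ⟨⟨‖Φ s₁‖, hbd⟩, ?_, ?_⟩, ?_⟩
  · -- the constant term `μ(ℤ_p^×) = ã⁻¹ [0]⁺_f`
    rw [h0]
    haveI : NeZero (p ^ 1) := ⟨pow_ne_zero _ hp.out.ne_zero⟩
    have h1 := sum_units_mul_of_distribution hdist (RingHom.id ℚ_[p]) (m := 1)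
      (L := cyclotomicExponent p) le_rfl (Nat.pos_of_ne_zero (cyclotomicExponent_ne_zero p))
      (fun _ ↦ (1 : ℚ_[p]))
    simp only [RingHom.id_apply, mul_one] at h1
    rw [h1, sum_units_eq_sum_filter_isUnit (F := fun a : ZMod (p ^ 1) ↦
      twistPartnerMeasure χ Φ ã ((ratPlusSymbol f 0 : ℚ) : ℚ_[p]) 1 a)]
    have hfil : Finset.univ.filter (fun a : ZMod (p ^ 1) ↦ IsUnit a) = Finset.univ.erase 0 := by
      ext a
      simp [isUnit_iff_ne_zero_level_one]
    rw [hfil, Finset.sum_erase_eq_sub (Finset.mem_univ _)]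
    have hz : twistPartnerMeasure χ Φ ã ((ratPlusSymbol f 0 : ℚ) : ℚ_[p]) 1 0 = 0 := by
      rw [twistPartnerMeasure_succ, ZMod.val_zero, Nat.cast_zero, MulChar.map_zero, mul_zero,
        zero_mul]
    rw [hz, sub_zero]
    simp_rw [twistPartnerMeasure_succ, zero_add, pow_one ã⁻¹, mul_assoc]
    rw [← Finset.mul_sum, sum_level_one_eq χ Φ, ← hx' 0]
  · -- the interpolation rows, `m ≥ 2`
    intro m hm κ hκ heven hord
    obtain ⟨m', rfl⟩ : ∃ m', m = m' + 1 := ⟨m - 1, by omega⟩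
    have h' := hint m' κ heven hord
    rwa [sum_mul_twistPartnerMeasure_eq hm hχ hper hx' hκ] at h'
  · -- integrality transfer: `max ‖Φ‖ ≤ C`
    intro C hCx n
    exact (hbd n).trans (norm_le_of_twist_partner χ hχ hã hper hx' hU hs₁ hCx)

variable {S : ℚ → ℚ_[p]} {ap α δ c : ℚ_[p]}

/-- **E3 twist transport at the Λ-level, kernel half: the E-normalised tame branch for THE unit
`α` from a Hecke-eigen symbol.** Under the hypotheses of `hasOrdinaryTwistPartner_of_heckeSymbol`
(Hecke-eigen lattice-valued `1`-periodic `S` with `[·]⁺_f = τ_{χ⁻¹}S`, unit root `α` of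
`X² − a_pX + δp`), there is `B ∈ ℚ_p⟦T⟧` with `IsTameBranchOf f p (ι∘χ) α B` — bounded,
`B(0) = α⁻¹[0]⁺_f`, `B(κ(γ)−1) = α^{−m}p^{−1}τ(ι∘χ,ψ_κ)∑_bκ(b)[b/p^m]⁺_f` — and
`‖[Tⁿ]B‖ ≤ C` for every bound `C` of the plus symbols of `f`. On defect 2 with `S = c·[·]^±_{f♭}`:
the premise of `TameBranchRatCharEqAt W p` inhabited with `α = unitRoot E♭ p` (good ordinary) resp.
`α = a_p(E♭) = ±1` (multiplicative, `δ = 0`), modulo the comparison statement `hx`. Nothing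
booked. [cite: MazurTateTeitelbaum1986Invent, §I.10 (10.1)–(10.2) and §I.14 (14.3)] -/
theorem exists_isTameBranchOf_of_heckeSymbol {χ : MulChar (ZMod p) ℚ_[p]} (hχ : χ ≠ 1)
    (hper : ∀ s, S (s + 1) = S s)
    (hx : ∀ s, ((ratPlusSymbol f s : ℚ) : ℚ_[p]) = CensusX43.twist χ⁻¹ S s)
    (hH : ∀ r : ℚ, ap * S r = ∑ j : Fin p, S ((r + ((j : ℕ) : ℚ)) / p) + δ * S (p * r))
    (hα : α ^ 2 - ap * α + δ * p = 0) (hαu : ‖α‖ = 1) (hδ : ‖δ‖ ≤ 1)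
    (hlat : ∀ s, ∃ z : ℤ_[p], S s = c * z) :
    ∃ B : PowerSeries ℚ_[p], IsTameBranchOf f p (χ.ringHomComp (algebraMap ℚ_[p] ℂ_[p])) α B ∧
      ∀ C : ℝ, (∀ r : ℚ, ‖((ratPlusSymbol f r : ℚ) : ℚ_[p])‖ ≤ C) →
        ∀ n : ℕ, ‖PowerSeries.coeff n B‖ ≤ C := by
  have hα0 : α ≠ 0 := fun h0 ↦ by rw [h0, norm_zero] at hαu; exact zero_ne_one hαu
  have hχi : χ⁻¹ ≠ 1 := fun h1 ↦ hχ (inv_eq_one.mp h1)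
  obtain ⟨s₁, hs₁⟩ :=
    exists_forall_norm_le_norm_of_forall_eq_mul (exists_stabilisedSymbol_eq_mul hαu hδ hlat)
  exact exists_isTameBranchOf_of_twistPartnerData hχ hαu (stabilisedSymbol_add_one hper)
    (fun s ↦ by rw [hx s, twist_stabilisedSymbol hper hχi]) (sum_stabilisedSymbol_eq hper hH hα hα0)
    hs₁

/-- **Integrality corollary**: if moreover the plus symbols of `f` are `p`-integral (`‖[r]⁺_f‖ ≤ 1`;
the `PlusSymbolsPIntegralAt` input of `TameBranchUpper.lean`, a THEOREM on `Irr(E[p])` rows by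
T-R18b), the tame branch for `α` is INTEGRAL, `B ∈ Λ = ℤ_p⟦T⟧ ⊗ 1`. [folklore] -/
theorem exists_isTameBranchOf_integral_of_heckeSymbol {χ : MulChar (ZMod p) ℚ_[p]} (hχ : χ ≠ 1)
    (hper : ∀ s, S (s + 1) = S s)
    (hx : ∀ s, ((ratPlusSymbol f s : ℚ) : ℚ_[p]) = CensusX43.twist χ⁻¹ S s)
    (hH : ∀ r : ℚ, ap * S r = ∑ j : Fin p, S ((r + ((j : ℕ) : ℚ)) / p) + δ * S (p * r))
    (hα : α ^ 2 - ap * α + δ * p = 0) (hαu : ‖α‖ = 1) (hδ : ‖δ‖ ≤ 1)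
    (hlat : ∀ s, ∃ z : ℤ_[p], S s = c * z)
    (hint : ∀ r : ℚ, ‖((ratPlusSymbol f r : ℚ) : ℚ_[p])‖ ≤ 1) :
    ∃ B : PowerSeries ℚ_[p], IsTameBranchOf f p (χ.ringHomComp (algebraMap ℚ_[p] ℂ_[p])) α B ∧
      ∀ n : ℕ, ‖PowerSeries.coeff n B‖ ≤ 1 := by
  obtain ⟨B, hB, hC⟩ := exists_isTameBranchOf_of_heckeSymbol hχ hper hx hH hα hαu hδ hlat
  exact ⟨B, hB, hC 1 hint⟩

end Bridge

end Summit.BirchSwinnertonDyer.Rank1Residual.Additive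

end
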